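import Literature.MathematicalPhysics.QuantumLattice.GrassmannEffectiveActionTruncation
import Literature.MathematicalPhysics.QuantumLattice.GrassmannGaussConvKernelBound
import HarnessLib

/-!
# One step of the flow of the kernels: `‖𝒱'_m‖ ≤ ‖V_m‖ + (Wick self-contractions) + (second order)`

Topic `MathematicalPhysics/QuantumLattice`; the packaging of `GrassmannGaussConvKernelBound.sum_norm_kernel_gaussConv_sub_le`
(the LINEAR part `e^{Δ_C}V - V` of the renormalisation-group map, kernel by kernel: self-contractions of the higher
kernels, each costing the sup norm `s` of the covariance) and `GrassmannEffectiveActionTruncation.sum_norm_kernel_effAction_sub_gaussConv_le`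
(the NON-LINEAR part `effAction C V - e^{Δ_C}V`, second order in `‖V‖_h`) into the inequality the scale induction consumes
(Benfatto–Giuliani–Mastropietro 2006, (2.86)–(2.90): `𝒱^{(h-1)} = 𝒱^{(h)} + (tadpoles) + Σ_{n ≥ 2} 𝓔ᵀ/n!`; Gawȩdzki–Kupiainen
1985, §3): with `θ = eα‖V‖_h/κ² < 1`, for every degree `m ≥ 1` and pinned output leg,

`Σ_{W : W_i = w} ‖kernel (effAction C V) m W‖ ≤ N(m) + Σ_{1 ≤ j < k} ((m+2j)!/(m! j! 2^j)) s^j N(m+2j) + ρ^{-m} e‖V‖_h θ/(1-θ)`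

(`sum_norm_kernel_effAction_le_flow`), where `N(n)` bounds the pinned norms of ALL kernels of `V` and `Δ_C^k = 0`.
In particular the TOP degree of a polynomial interaction does not move at first order (no higher kernels to contract):
for a quartic `V`, `‖λ' - λ‖ ≤ ρ^{-4} e‖V‖_h θ/(1-θ) = O(‖V‖_h²)` (`sum_norm_kernel_effAction_sub_le_of_top`).

Everything is proved; no definition, no named fact.

## Sources

G. Benfatto, A. Giuliani, V. Mastropietro, Ann. Henri Poincaré 7 (2006) 809–898, (2.86)–(2.90)
[`BenfattoGiulianiMastropietro2006`]; K. Gawȩdzki, A. Kupiainen, Comm. Math. Phys. 102 (1985) 1–30, §3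
[`GawedzkiKupiainen1985GrossNeveu`].
-/

noncomputable section

namespace Literature.MathematicalPhysics.QuantumLattice

open GrassmannAlgebra Finset Literature.Probability.LatticeModels
open scoped InnerProductSpace Nat

variable {𝕜 : Type*} [RCLike 𝕜] {Γ : Type*} [Fintype Γ] [DecidableEq Γ] (C : Matrix Γ Γ 𝕜)

/-- **One step of the flow of the kernels** (BGM 2006, (2.86)–(2.90)): with `θ = eα‖V‖_h/κ² < 1`, `‖C(A,B)‖ ≤ s`,
`Δ_C^k = 0` and pinned norms `N(n)` of all the kernels of `V`, for every degree `m ≥ 1` and pinned output leg,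
`Σ_{W : W_i = w} ‖kernel (effAction C V) m W‖ ≤ N(m) + Σ_{1 ≤ j < k} ((m+2j)!/(m! j! 2^j)) s^j N(m+2j) + ρ^{-m} e‖V‖_h θ/(1-θ)`.
[cite: BenfattoGiulianiMastropietro2006, (2.86)-(2.90)] -/
theorem sum_norm_kernel_effAction_le_flow {E : Type*} [NormedAddCommGroup E] [InnerProductSpace 𝕜 E]
    (q : Γ → Bool) (hC : ∀ X Y, q X = q Y → C X Y = 0) (f g : Γ → E) {κ : ℝ} (hκ : 0 < κ)
    (hf : ∀ X, q X = true → ‖f X‖ ≤ κ) (hg : ∀ Y, q Y = false → ‖g Y‖ ≤ κ)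
    (hG : ∀ X Y, q X = true → q Y = false → contr 𝕜 C X Y = ⟪f X, g Y⟫_𝕜)
    (V : GrassmannAlgebra 𝕜 Γ) (hV : V ∈ evenPart 𝕜 Γ) (hV0 : constPart 𝕜 V = 0) (N : ℕ → ℝ) (hN0 : ∀ n, 0 ≤ N n)
    (hN : ∀ (n : ℕ) (p : Fin n) (w : Γ), ∑ Y ∈ univ.filter (fun Y : Fin n → Γ => Y p = w), ‖kernel 𝕜 V n Y‖ ≤ N n)
    {α : ℝ} (hα : 0 < α) (hrow : ∀ X, ∑ Y, ‖C X Y‖ ≤ α) (hcol : ∀ Y, ∑ X, ‖C X Y‖ ≤ α) {ρ : ℝ} (hρ : 0 < ρ)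
    (hθ : Real.exp 1 * α * normV Γ κ ρ (fun m' => N (2 * m')) / κ ^ 2 < 1)
    {s : ℝ} (hs : ∀ A B, ‖C A B‖ ≤ s) {k : ℕ} (hk : grassmannLaplacian 𝕜 C ^ k = 0)
    {m : ℕ} (hm : 0 < m) (i : Fin m) (w : Γ) :
    ∑ W ∈ univ.filter (fun W : Fin m → Γ => W i = w), ‖kernel 𝕜 (effAction 𝕜 C V) m W‖ ≤
      N m + ∑ j ∈ Ico 1 k, ((m + 2 * j)! : ℝ) / ((m ! : ℝ) * (j ! : ℝ) * 2 ^ j) * s ^ j * N (m + 2 * j) +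
        ρ⁻¹ ^ m * (Real.exp 1 * normV Γ κ ρ (fun m' => N (2 * m'))) *
          (Real.exp 1 * α * normV Γ κ ρ (fun m' => N (2 * m')) / κ ^ 2) /
            (1 - Real.exp 1 * α * normV Γ κ ρ (fun m' => N (2 * m')) / κ ^ 2) := by
  -- the three pieces
  have h1 := hN m i w
  have h2 := sum_norm_kernel_gaussConv_sub_le C hk hs V N hN m i w
  obtain ⟨-, h3⟩ := sum_norm_kernel_effAction_sub_gaussConv_le C q hC f g hκ hf hg hG V hV hV0 (fun m' => N (2 * m'))
    (fun m' => hN0 _) (fun m' j w' => hN (2 * m') j w') hα hrow hcol hρ hθ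
  have h3' := h3 hm i w
  -- `𝒱' = V + (e^{Δ}V - V) + (𝒱' - e^{Δ}V)`
  have hsplit : ∀ W, kernel 𝕜 (effAction 𝕜 C V) m W = kernel 𝕜 V m W + kernel 𝕜 (gaussConv 𝕜 C V - V) m W +
      kernel 𝕜 (effAction 𝕜 C V - gaussConv 𝕜 C V) m W := by
    intro W
    rw [← kernel_add, ← kernel_add]
    congr 1
    abel
  calc ∑ W ∈ univ.filter (fun W : Fin m → Γ => W i = w), ‖kernel 𝕜 (effAction 𝕜 C V) m W‖
      ≤ ∑ W ∈ univ.filter (fun W : Fin m → Γ => W i = w), (‖kernel 𝕜 V m W‖ + ‖kernel 𝕜 (gaussConv 𝕜 C V - V) m W‖ +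
          ‖kernel 𝕜 (effAction 𝕜 C V - gaussConv 𝕜 C V) m W‖) :=
        sum_le_sum fun W _ => by rw [hsplit W]; exact norm_add₃_le
    _ = _ := by rw [sum_add_distrib, sum_add_distrib]
    _ ≤ _ := add_le_add (add_le_add h1 h2) h3'

/-- **The top degree does not move at first order**: if `V` has no kernels above degree `m` (`N(n) = 0` for `n > m`; e.g. a
quartic interaction and `m = 4`), then `Σ_{W : W_i = w} ‖kernel (effAction C V - V) m W‖ ≤ ρ^{-m} e‖V‖_h θ/(1-θ)`: the
running coupling of the top degree changes only at second order in `‖V‖_h` (Gawȩdzki–Kupiainen 1985, §3: `λ' = λ + O(λ²)`).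
[cite: BenfattoGiulianiMastropietro2006, (2.86)-(2.90)] -/
theorem sum_norm_kernel_effAction_sub_le_of_top {E : Type*} [NormedAddCommGroup E] [InnerProductSpace 𝕜 E]
    (q : Γ → Bool) (hC : ∀ X Y, q X = q Y → C X Y = 0) (f g : Γ → E) {κ : ℝ} (hκ : 0 < κ)
    (hf : ∀ X, q X = true → ‖f X‖ ≤ κ) (hg : ∀ Y, q Y = false → ‖g Y‖ ≤ κ)
    (hG : ∀ X Y, q X = true → q Y = false → contr 𝕜 C X Y = ⟪f X, g Y⟫_𝕜)
    (V : GrassmannAlgebra 𝕜 Γ) (hV : V ∈ evenPart 𝕜 Γ) (hV0 : constPart 𝕜 V = 0) (N : ℕ → ℝ) (hN0 : ∀ n, 0 ≤ N n)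
    (hN : ∀ (n : ℕ) (p : Fin n) (w : Γ), ∑ Y ∈ univ.filter (fun Y : Fin n → Γ => Y p = w), ‖kernel 𝕜 V n Y‖ ≤ N n)
    {α : ℝ} (hα : 0 < α) (hrow : ∀ X, ∑ Y, ‖C X Y‖ ≤ α) (hcol : ∀ Y, ∑ X, ‖C X Y‖ ≤ α) {ρ : ℝ} (hρ : 0 < ρ)
    (hθ : Real.exp 1 * α * normV Γ κ ρ (fun m' => N (2 * m')) / κ ^ 2 < 1)
    {m : ℕ} (hm : 0 < m) (htop : ∀ n, m < n → N n = 0) (i : Fin m) (w : Γ) :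
    ∑ W ∈ univ.filter (fun W : Fin m → Γ => W i = w), ‖kernel 𝕜 (effAction 𝕜 C V - V) m W‖ ≤
      ρ⁻¹ ^ m * (Real.exp 1 * normV Γ κ ρ (fun m' => N (2 * m'))) *
        (Real.exp 1 * α * normV Γ κ ρ (fun m' => N (2 * m')) / κ ^ 2) /
          (1 - Real.exp 1 * α * normV Γ κ ρ (fun m' => N (2 * m')) / κ ^ 2) := by
  obtain ⟨k, hk⟩ := isNilpotent_grassmannLaplacian 𝕜 C
  -- a sup bound for `C`: every entry is at most a row sum
  have hs : ∀ A B, ‖C A B‖ ≤ α := fun A B =>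
    (single_le_sum (f := fun Y => ‖C A Y‖) (fun Y _ => norm_nonneg _) (mem_univ B)).trans (hrow A)
  have h2 := sum_norm_kernel_gaussConv_sub_le C hk hs V N hN m i w
  obtain ⟨-, h3⟩ := sum_norm_kernel_effAction_sub_gaussConv_le C q hC f g hκ hf hg hG V hV hV0 (fun m' => N (2 * m'))
    (fun m' => hN0 _) (fun m' j w' => hN (2 * m') j w') hα hrow hcol hρ hθ
  have h3' := h3 hm i w
  -- the Wick sum vanishes: no higher kernels
  have hzero : ∑ j ∈ Ico 1 k, ((m + 2 * j)! : ℝ) / ((m ! : ℝ) * (j ! : ℝ) * 2 ^ j) * α ^ j * N (m + 2 * j) = 0 :=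
    sum_eq_zero fun j hj => by rw [htop (m + 2 * j) (by have := (mem_Ico.1 hj).1; omega), mul_zero]
  rw [hzero] at h2
  have hsplit : ∀ W, kernel 𝕜 (effAction 𝕜 C V - V) m W = kernel 𝕜 (gaussConv 𝕜 C V - V) m W +
      kernel 𝕜 (effAction 𝕜 C V - gaussConv 𝕜 C V) m W := by
    intro W
    rw [← kernel_add]
    congr 1
    abel
  calc ∑ W ∈ univ.filter (fun W : Fin m → Γ => W i = w), ‖kernel 𝕜 (effAction 𝕜 C V - V) m W‖
      ≤ ∑ W ∈ univ.filter (fun W : Fin m → Γ => W i = w), (‖kernel 𝕜 (gaussConv 𝕜 C V - V) m W‖ +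
          ‖kernel 𝕜 (effAction 𝕜 C V - gaussConv 𝕜 C V) m W‖) :=
        sum_le_sum fun W _ => by rw [hsplit W]; exact norm_add_le _ _
    _ = _ := by rw [sum_add_distrib]
    _ ≤ 0 + _ := add_le_add h2 h3'
    _ = _ := zero_add _

end Literature.MathematicalPhysics.QuantumLattice
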